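import Literature.Analysis.OperatorTheory.HilbertSchmidtPairing
import HarnessLib

/-!
# Transport of Hilbert–Schmidt pairings and diagonal sums ("traces") along unitary equivalences
# (Reed–Simon I, Thm. VI.22 (e), VI.24; Dixmier, *C\*-algebras* §13.1.3)

Topic `Literature/Analysis/OperatorTheory`; namespace `Literature.Analysis.OperatorTheory`. THEOREMS ONLY (no definition, no named
fact, no instance, no notation); continuation of `HilbertSchmidtOrthogonalSum.lean` (`tsum_enorm_sq_conj_apply_eq`: the Hilbert–Schmidt
SUM `Σ ‖T e_i‖²` is invariant under `T ↦ U' T U⁻¹`) and `HilbertSchmidtPairing.lean` (basis independence of the pairing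
`Σ_i ⟨A e_i, B e_i⟩` INSIDE one space). Here the two spaces are DIFFERENT Hilbert spaces `E`, `E'` identified by a unitary
`U : E ≃ₗᵢ E'`, and the operators are intertwined: `A' ∘ U = U' ∘ A`.

What is proved (all for `𝕜 = ℝ` or `ℂ`, `U : E ≃ₗᵢ[𝕜] E'`, `U' : F ≃ₗᵢ[𝕜] F'`, bounded `A, B : E → F`, `A', B' : E' → F'` with
`A' (U x) = U' (A x)`, `B' (U x) = U' (B x)`; Hilbert bases `b` of `E`, `b'` of `E'` with ARBITRARY index types):

* `summable_norm_sq_apply_of_conj` — if `A` is Hilbert–Schmidt along `b` (`Σ_k ‖A b_k‖² < ∞`, the tree's typing of "Hilbert–Schmidt",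
  Mathlib has no trace class) then `A'` is Hilbert–Schmidt along `b'`;
* `tsum_inner_apply_apply_eq_of_conj` — **the Hilbert–Schmidt pairing is a unitary invariant**:
  `Σ_j ⟨A' b'_j, B' b'_j⟩ = Σ_k ⟨A b_k, B b_k⟩` (`A`, `B` Hilbert–Schmidt along `b`), with the `HasSum`/`Summable` forms;
* `tsum_inner_diag_eq_of_conj`, `summable_inner_diag_of_conj` — **the diagonal sum `Σ_j ⟨b'_j, A' b'_j⟩` ("the trace") is a unitary
  invariant** once the diagonal sums of `A` are summable ∕ basis-free along the Hilbert bases of `E` indexed by the index type of `b'`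
  (the only bases the proof transports to); `traceTriple_of_conj` — the three consequences of «trace class» used by the tree
  (Hilbert–Schmidt along every basis, summable diagonal along every basis, basis-free value; cf. `UnitaryGroupArchCharacterTraceClass`)
  pass from `A` to `A'`, and `tsum_inner_diag_eq_of_traceTriple` — the two traces agree.

Method: transport the basis (`exists_hilbertBasis_map_linearIsometryEquiv`: `U ∘ b` is a Hilbert basis of `E'`, `U⁻¹ ∘ b'` one of `E`),
compare termwise (`U'.inner_map_map`, `U.norm_map`), and change basis inside ONE space with ★ `hasSum_norm_sq_apply_of_hasSum` ∕
★ `tsum_inner_apply_apply_eq_of_hilbertBasis`. Used by `NumberTheory/Automorphic/HilbertRepCharacterTransport` (characters of unitarily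
equivalent representations agree).

## References
* M. Reed, B. Simon, *Methods of Modern Mathematical Physics I* (1972), Thm. VI.22 (e), Thm. VI.24 (PDF pp. 198–199) [ReedSimon1972].
* J. Dixmier, *C\*-algebras* (1977), §13.1.3 (unitary equivalence) [Dixmier1977].
-/

noncomputable section

open scoped InnerProductSpace

namespace Literature.Analysis.OperatorTheory

variable {𝕜 : Type*} [RCLike 𝕜]
variable {E E' F F' : Type*}
  [NormedAddCommGroup E] [InnerProductSpace 𝕜 E]
  [NormedAddCommGroup E'] [InnerProductSpace 𝕜 E']
  [NormedAddCommGroup F] [InnerProductSpace 𝕜 F]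
  [NormedAddCommGroup F'] [InnerProductSpace 𝕜 F']

/-! ### Hilbert–Schmidt sums and pairings -/

section Pairing

variable (U : E ≃ₗᵢ[𝕜] E') (U' : F ≃ₗᵢ[𝕜] F')

/-- Along the TRANSPORTED basis `U ∘ b` the norms agree termwise: `‖A' (U b_k)‖ = ‖A b_k‖` when `A' ∘ U = U' ∘ A`.
[cite: ReedSimon1972, Thm. VI.22, PDF p. 198] -/
theorem norm_apply_map_eq_of_conj (A : E →L[𝕜] F) (A' : E' →L[𝕜] F') (hA : ∀ x, A' (U x) = U' (A x)) (x : E) :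
    ‖A' (U x)‖ = ‖A x‖ := by
  rw [hA, U'.norm_map]

/-- Along the transported basis the pairings agree termwise: `⟨A' (U x), B' (U x)⟩ = ⟨A x, B x⟩`.
[cite: ReedSimon1972, Thm. VI.22 (e), PDF p. 198] -/
theorem inner_apply_map_apply_map_eq_of_conj (A B : E →L[𝕜] F) (A' B' : E' →L[𝕜] F')
    (hA : ∀ x, A' (U x) = U' (A x)) (hB : ∀ x, B' (U x) = U' (B x)) (x : E) :
    ⟪A' (U x), B' (U x)⟫_𝕜 = ⟪A x, B x⟫_𝕜 := by
  rw [hA, hB, U'.inner_map_map]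

/-- **Hilbert–Schmidt is a unitary invariant** (real, `Summable` form): if `Σ_k ‖A b_k‖²` converges for a Hilbert basis `b` of `E`
and `A' (U x) = U' (A x)`, then `Σ_j ‖A' b'_j‖²` converges for every Hilbert basis `b'` of `E'`.
[cite: ReedSimon1972, Thm. VI.22 (b), PDF p. 198] -/
theorem summable_norm_sq_apply_of_conj [CompleteSpace E'] [CompleteSpace F'] {ι ι' : Type*} (b : HilbertBasis ι 𝕜 E) (b' : HilbertBasis ι' 𝕜 E')
    (A : E →L[𝕜] F) (A' : E' →L[𝕜] F') (hA : ∀ x, A' (U x) = U' (A x))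
    (h : Summable fun k => ‖A (b k)‖ ^ 2) : Summable fun j => ‖A' (b' j)‖ ^ 2 := by
  obtain ⟨bU, hbU⟩ := exists_hilbertBasis_map_linearIsometryEquiv b U
  have hU : Summable fun k => ‖A' (bU k)‖ ^ 2 := by
    simp_rw [hbU, norm_apply_map_eq_of_conj U U' A A' hA]
    exact h
  exact (hasSum_norm_sq_apply_of_hasSum bU b' A' hU.hasSum).summable

/-- The Hilbert–Schmidt sums themselves agree: `Σ_j ‖A' b'_j‖² = Σ_k ‖A b_k‖²` (`HasSum` form).
[cite: ReedSimon1972, Thm. VI.22 (b), PDF p. 198] -/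
theorem hasSum_norm_sq_apply_of_conj [CompleteSpace E'] [CompleteSpace F'] {ι ι' : Type*} (b : HilbertBasis ι 𝕜 E) (b' : HilbertBasis ι' 𝕜 E')
    (A : E →L[𝕜] F) (A' : E' →L[𝕜] F') (hA : ∀ x, A' (U x) = U' (A x))
    {M : ℝ} (h : HasSum (fun k => ‖A (b k)‖ ^ 2) M) : HasSum (fun j => ‖A' (b' j)‖ ^ 2) M := by
  obtain ⟨bU, hbU⟩ := exists_hilbertBasis_map_linearIsometryEquiv b U
  have hU : HasSum (fun k => ‖A' (bU k)‖ ^ 2) M := by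
    simp_rw [hbU, norm_apply_map_eq_of_conj U U' A A' hA]
    exact h
  exact hasSum_norm_sq_apply_of_hasSum bU b' A' hU

/-- **The Hilbert–Schmidt pairing is a unitary invariant**: for `A' ∘ U = U' ∘ A`, `B' ∘ U = U' ∘ B` with `A`, `B` Hilbert–Schmidt along a
Hilbert basis `b` of `E`, and ANY Hilbert basis `b'` of `E'`, `Σ_j ⟨A' b'_j, B' b'_j⟩ = Σ_k ⟨A b_k, B b_k⟩` — the «trace of `A† B`» read in
`E'` (transport `b` along `U`, compare termwise, then basis independence inside `E'`).
[cite: ReedSimon1972, Thm. VI.22 (e) and Thm. VI.24, PDF pp. 198–199] [cite: Dixmier1977, §13.1.3] -/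
theorem tsum_inner_apply_apply_eq_of_conj [CompleteSpace E'] [CompleteSpace F'] {ι ι' : Type*} (b : HilbertBasis ι 𝕜 E) (b' : HilbertBasis ι' 𝕜 E')
    (A B : E →L[𝕜] F) (A' B' : E' →L[𝕜] F') (hA : ∀ x, A' (U x) = U' (A x)) (hB : ∀ x, B' (U x) = U' (B x))
    (hAs : Summable fun k => ‖A (b k)‖ ^ 2) (hBs : Summable fun k => ‖B (b k)‖ ^ 2) :
    ∑' j, ⟪A' (b' j), B' (b' j)⟫_𝕜 = ∑' k, ⟪A (b k), B (b k)⟫_𝕜 := by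
  obtain ⟨bU, hbU⟩ := exists_hilbertBasis_map_linearIsometryEquiv b U
  have hAU : Summable fun k => ‖A' (bU k)‖ ^ 2 := by
    simp_rw [hbU, norm_apply_map_eq_of_conj U U' A A' hA]; exact hAs
  have hBU : Summable fun k => ‖B' (bU k)‖ ^ 2 := by
    simp_rw [hbU, norm_apply_map_eq_of_conj U U' B B' hB]; exact hBs
  rw [← tsum_inner_apply_apply_eq_of_hilbertBasis bU b' A' B' hAU hBU]
  exact tsum_congr fun k => by rw [hbU, inner_apply_map_apply_map_eq_of_conj U U' A B A' B' hA hB]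

/-- `HasSum` form of the unitary invariance of the pairing. [cite: ReedSimon1972, Thm. VI.24, PDF p. 199] -/
theorem hasSum_inner_apply_apply_of_conj [CompleteSpace E'] [CompleteSpace F'] {ι ι' : Type*} (b : HilbertBasis ι 𝕜 E) (b' : HilbertBasis ι' 𝕜 E')
    (A B : E →L[𝕜] F) (A' B' : E' →L[𝕜] F') (hA : ∀ x, A' (U x) = U' (A x)) (hB : ∀ x, B' (U x) = U' (B x))
    (hAs : Summable fun k => ‖A (b k)‖ ^ 2) (hBs : Summable fun k => ‖B (b k)‖ ^ 2)
    {s : 𝕜} (hs : HasSum (fun k => ⟪A (b k), B (b k)⟫_𝕜) s) : HasSum (fun j => ⟪A' (b' j), B' (b' j)⟫_𝕜) s := by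
  have hA' := summable_norm_sq_apply_of_conj U U' b b' A A' hA hAs
  have hB' := summable_norm_sq_apply_of_conj U U' b b' B B' hB hBs
  have h := (summable_inner_apply_apply b' A' B' hA' hB').hasSum
  rwa [tsum_inner_apply_apply_eq_of_conj U U' b b' A B A' B' hA hB hAs hBs, hs.tsum_eq] at h

end Pairing

/-! ### Diagonal sums ("traces") -/

section Diagonal

variable (U : E ≃ₗᵢ[𝕜] E')

/-- Along the transported basis the diagonal terms agree: `⟨U x, A' (U x)⟩ = ⟨x, A x⟩` when `A' ∘ U = U ∘ A`.
[cite: ReedSimon1972, Thm. VI.24, PDF p. 199] -/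
theorem inner_map_apply_map_eq_of_conj (A : E →L[𝕜] E) (A' : E' →L[𝕜] E') (hA : ∀ x, A' (U x) = U (A x)) (x : E) :
    ⟪U x, A' (U x)⟫_𝕜 = ⟪x, A x⟫_𝕜 := by
  rw [hA, U.inner_map_map]

/-- **Summability of the diagonal is a unitary invariant**: if the diagonal family `j ↦ ⟨c_j, A c_j⟩` is summable for every Hilbert basis
`c` of `E` indexed by `ι'`, and `A' ∘ U = U ∘ A`, then `j ↦ ⟨b'_j, A' b'_j⟩` is summable for every Hilbert basis `b'` of `E'` indexed by
`ι'` (transport `b'` back along `U⁻¹`). [cite: ReedSimon1972, Thm. VI.24, PDF p. 199] -/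
theorem summable_inner_diag_of_conj {ι' : Type*} (b' : HilbertBasis ι' 𝕜 E') (A : E →L[𝕜] E) (A' : E' →L[𝕜] E')
    (hA : ∀ x, A' (U x) = U (A x)) (hsum : ∀ c : HilbertBasis ι' 𝕜 E, Summable fun j => ⟪(c j : E), A (c j)⟫_𝕜) :
    Summable fun j => ⟪(b' j : E'), A' (b' j)⟫_𝕜 := by
  obtain ⟨c, hc⟩ := exists_hilbertBasis_map_linearIsometryEquiv b' U.symm
  have hb' : ∀ j, b' j = U (c j) := fun j => by rw [hc, U.apply_symm_apply]
  simp_rw [hb', inner_map_apply_map_eq_of_conj U A A' hA]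
  exact hsum c

/-- **The trace is a unitary invariant**: if `A' ∘ U = U ∘ A` and the diagonal sum of `A` along every Hilbert basis of `E` indexed by
`ι'` equals its value along `b`, then `Σ_j ⟨b'_j, A' b'_j⟩ = Σ_k ⟨b_k, A b_k⟩` for every Hilbert basis `b'` of `E'` indexed by `ι'`
(Reed–Simon VI.24: the trace of a trace-class operator does not depend on the basis; here the basis-freeness is the HYPOTHESIS, typed
as the tree types «trace class»). [cite: ReedSimon1972, Thm. VI.24, PDF p. 199] [cite: Dixmier1977, §13.1.3] -/
theorem tsum_inner_diag_eq_of_conj {ι ι' : Type*} (b : HilbertBasis ι 𝕜 E) (b' : HilbertBasis ι' 𝕜 E')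
    (A : E →L[𝕜] E) (A' : E' →L[𝕜] E') (hA : ∀ x, A' (U x) = U (A x))
    (hfree : ∀ c : HilbertBasis ι' 𝕜 E, ∑' j, ⟪(c j : E), A (c j)⟫_𝕜 = ∑' k, ⟪(b k : E), A (b k)⟫_𝕜) :
    ∑' j, ⟪(b' j : E'), A' (b' j)⟫_𝕜 = ∑' k, ⟪(b k : E), A (b k)⟫_𝕜 := by
  obtain ⟨c, hc⟩ := exists_hilbertBasis_map_linearIsometryEquiv b' U.symm
  have hb' : ∀ j, b' j = U (c j) := fun j => by rw [hc, U.apply_symm_apply]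
  simp_rw [hb', inner_map_apply_map_eq_of_conj U A A' hA]
  exact hfree c

/-- The same with BOTH sides read along arbitrary bases: if the diagonal sums of `A` are basis-free among the Hilbert bases of `E` indexed
by `ι` and by `ι'`, then the diagonal sum of `A'` along any `ι'`-indexed basis of `E'` equals that of `A` along any `ι`-indexed basis of `E`.
[cite: ReedSimon1972, Thm. VI.24, PDF p. 199] -/
theorem tsum_inner_diag_eq_of_conj' {ι ι' : Type*} (b : HilbertBasis ι 𝕜 E) (b' : HilbertBasis ι' 𝕜 E')
    (A : E →L[𝕜] E) (A' : E' →L[𝕜] E') (hA : ∀ x, A' (U x) = U (A x))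
    (hfree : ∀ (c : HilbertBasis ι' 𝕜 E) (c₀ : HilbertBasis ι 𝕜 E),
      ∑' j, ⟪(c j : E), A (c j)⟫_𝕜 = ∑' k, ⟪(c₀ k : E), A (c₀ k)⟫_𝕜) :
    ∑' j, ⟪(b' j : E'), A' (b' j)⟫_𝕜 = ∑' k, ⟪(b k : E), A (b k)⟫_𝕜 :=
  tsum_inner_diag_eq_of_conj U b b' A A' hA fun c => hfree c b

/-- **The «trace class» triple is a unitary invariant.** The tree (which has no trace class) reads «`A` is trace class» as: along EVERY
Hilbert basis `c` of `E` (index types in one universe), (i) `Σ ‖A c_k‖² < ∞`, (ii) the diagonal `k ↦ ⟨c_k, A c_k⟩` is summable, (iii) its sum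
does not depend on `c`. If `A' ∘ U = U ∘ A` for a unitary `U : E ≃ E'`, the same triple holds for `A'` along every Hilbert basis of `E'`
(index types in the same universe), and the traces agree (`tsum_inner_diag_eq_of_traceTriple`).
[cite: ReedSimon1972, Thm. VI.22 (b) and Thm. VI.24, PDF pp. 198–199] [cite: Dixmier1977, §13.1.3] -/
theorem traceTriple_of_conj.{w} [CompleteSpace E'] (A : E →L[𝕜] E) (A' : E' →L[𝕜] E') (hA : ∀ x, A' (U x) = U (A x))
    (h : ∀ (κ : Type w) (c : HilbertBasis κ 𝕜 E),
      (Summable fun k => ‖A (c k)‖ ^ 2) ∧ (Summable fun k => ⟪(c k : E), A (c k)⟫_𝕜) ∧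
        ∀ (κ₂ : Type w) (c₂ : HilbertBasis κ₂ 𝕜 E), ∑' k, ⟪(c k : E), A (c k)⟫_𝕜 = ∑' k, ⟪(c₂ k : E), A (c₂ k)⟫_𝕜)
    (κ : Type w) (c' : HilbertBasis κ 𝕜 E') :
    (Summable fun k => ‖A' (c' k)‖ ^ 2) ∧ (Summable fun k => ⟪(c' k : E'), A' (c' k)⟫_𝕜) ∧
      ∀ (κ₂ : Type w) (c₂' : HilbertBasis κ₂ 𝕜 E'), ∑' k, ⟪(c' k : E'), A' (c' k)⟫_𝕜 = ∑' k, ⟪(c₂' k : E'), A' (c₂' k)⟫_𝕜 := by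
  obtain ⟨c, hc⟩ := exists_hilbertBasis_map_linearIsometryEquiv c' U.symm
  refine ⟨summable_norm_sq_apply_of_conj U U c c' A A' hA (h κ c).1,
    summable_inner_diag_of_conj U c' A A' hA fun d => (h κ d).2.1, fun κ₂ c₂' => ?_⟩
  obtain ⟨c₂, hc₂⟩ := exists_hilbertBasis_map_linearIsometryEquiv c₂' U.symm
  rw [tsum_inner_diag_eq_of_conj U c c' A A' hA fun d => (h κ d).2.2 κ c,
    tsum_inner_diag_eq_of_conj U c₂ c₂' A A' hA fun d => (h κ₂ d).2.2 κ₂ c₂]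
  exact (h κ c).2.2 κ₂ c₂

/-- **Equal traces** under the triple: `Σ_j ⟨c'_j, A' c'_j⟩ = Σ_k ⟨c_k, A c_k⟩` for every Hilbert basis `c` of `E` and `c'` of `E'`
(index types in the universe of the hypothesis). [cite: ReedSimon1972, Thm. VI.24, PDF p. 199] [cite: Dixmier1977, §13.1.3] -/
theorem tsum_inner_diag_eq_of_traceTriple.{w} (A : E →L[𝕜] E) (A' : E' →L[𝕜] E') (hA : ∀ x, A' (U x) = U (A x))
    (h : ∀ (κ : Type w) (c : HilbertBasis κ 𝕜 E),
      (Summable fun k => ‖A (c k)‖ ^ 2) ∧ (Summable fun k => ⟪(c k : E), A (c k)⟫_𝕜) ∧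
        ∀ (κ₂ : Type w) (c₂ : HilbertBasis κ₂ 𝕜 E), ∑' k, ⟪(c k : E), A (c k)⟫_𝕜 = ∑' k, ⟪(c₂ k : E), A (c₂ k)⟫_𝕜)
    {κ κ' : Type w} (c : HilbertBasis κ 𝕜 E) (c' : HilbertBasis κ' 𝕜 E') :
    ∑' j, ⟪(c' j : E'), A' (c' j)⟫_𝕜 = ∑' k, ⟪(c k : E), A (c k)⟫_𝕜 :=
  tsum_inner_diag_eq_of_conj U c c' A A' hA fun d => (h κ' d).2.2 κ c

end Diagonal

end Literature.Analysis.OperatorTheory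

end
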